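import Literature.Probability.Independence.LovaszLocalLemma
import Mathlib.Analysis.SpecialFunctions.Exp
import HarnessLib

/-!
# The Lovász Local Lemma — symmetric form (counting form, variable version)

The SYMMETRIC Lovász Local Lemma with Spencer's constant `e`: if every event has probability
`≤ p`, every event shares coordinates with at most `d` others, and `e p (d+1) ≤ 1`, then some
sample point avoids all events. Derived from the asymmetric variable version
(`Literature.Probability.Independence.exists_forall_not_mem_of_variable`) with the weights
`x i = 1/(d+1)` (`d ≥ 1`; `x i = 1/2` when `d = 0`) and the estimate `(1 - 1/(d+1))^d ≥ 1/e`.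

* `exp_neg_one_le_one_sub_div_pow` — `exp(-1) ≤ (1 - 1/(d+1))^d`;
* `exists_forall_not_mem_of_symmetric` — the symmetric local lemma, variable version.

References: P. Erdős, L. Lovász (1975) (with the constant `4`); J. Spencer, *Asymptotic lower
bounds for Ramsey functions*, Discrete Math. 20 (1977) (the constant `e`); N. Alon, J. Spencer,
*The Probabilistic Method* (4th ed., Wiley 2016), Cor. 5.1.2.
-/

namespace Literature.Probability.Independence

open Finset

/-- `exp(-1) ≤ (1 - 1/(d+1))^d`: since `1 + 1/d ≤ exp(1/d)`, `(d/(d+1))^d ≥ exp(-1/d)^d = exp(-1)`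
(and the two sides are `exp(-1) ≤ 1` for `d = 0`). [folklore] -/
theorem exp_neg_one_le_one_sub_div_pow (d : ℕ) :
    Real.exp (-1) ≤ (1 - 1 / ((d : ℝ) + 1)) ^ d := by
  rcases Nat.eq_zero_or_pos d with rfl | hd
  · simp only [pow_zero]
    exact Real.exp_le_one_iff.2 (by norm_num)
  have hd0 : (0 : ℝ) < d := by exact_mod_cast hd
  -- `1 - 1/(d+1) = (1 + 1/d)⁻¹ ≥ exp(1/d)⁻¹ = exp(-1/d)`
  have hstep : Real.exp (-(1 / (d : ℝ))) ≤ 1 - 1 / ((d : ℝ) + 1) := by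
    have h1 : 1 + 1 / (d : ℝ) ≤ Real.exp (1 / (d : ℝ)) := by
      have := Real.add_one_le_exp (1 / (d : ℝ)); linarith
    have h2 : 1 - 1 / ((d : ℝ) + 1) = (1 + 1 / (d : ℝ))⁻¹ := by
      field_simp; ring
    rw [h2, Real.exp_neg]
    exact inv_anti₀ (by positivity) h1
  have hpow := pow_le_pow_left₀ (Real.exp_pos _).le hstep d
  have heq : Real.exp (-(1 / (d : ℝ))) ^ d = Real.exp (-1) := by
    rw [← Real.exp_nat_mul]; congr 1; field_simp
  rw [heq] at hpow
  exact hpow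

/-- **The symmetric Lovász Local Lemma (variable version, counting form).** Let `A i` (`i ∈ I`)
be events in the product space `V → κ`, each determined by the coordinates in `vbl i`. If
`|A i| ≤ p · |κ|^|V|` for every `i ∈ I`, every `i ∈ I` shares a coordinate with at most `d`
other indices `j ∈ I`, and `e · p · (d + 1) ≤ 1`, then some point lies in no `A i`.
[cite: AlonSpencer2016, Cor. 5.1.2 (symmetric case of Lemma 5.1.1)] -/
theorem exists_forall_not_mem_of_symmetric {V κ ι : Type*} [Fintype V] [DecidableEq V]
    [Fintype κ] [DecidableEq κ] [Nonempty κ] [DecidableEq ι]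
    (I : Finset ι) (A : ι → Finset (V → κ)) [∀ i, DecidablePred (· ∈ A i)] (vbl : ι → Finset V)
    (hdet : ∀ i ∈ I, ∀ ω ω' : V → κ, (∀ v ∈ vbl i, ω v = ω' v) → ω ∈ A i → ω' ∈ A i)
    (p : ℝ) (d : ℕ) (hp : ∀ i ∈ I, ((A i).card : ℝ) ≤ p * Fintype.card (V → κ))
    (hd : ∀ i ∈ I, (I.filter fun j => j ≠ i ∧ ¬ Disjoint (vbl i) (vbl j)).card ≤ d)
    (hepd : Real.exp 1 * p * ((d : ℝ) + 1) ≤ 1) :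
    ∃ ω : V → κ, ∀ i ∈ I, ω ∉ A i := by
  classical
  have he : (0 : ℝ) < Real.exp 1 := Real.exp_pos 1
  have he2 : (2 : ℝ) ≤ Real.exp 1 := by
    have := Real.add_one_le_exp (1 : ℝ); linarith
  -- `p ≤ 1/(e (d+1))`
  have hpe : p ≤ 1 / (Real.exp 1 * ((d : ℝ) + 1)) := by
    rw [le_div_iff₀ (by positivity)]; linarith [hepd]
  -- the weight `x = 1/(max d 1 + 1)` and the key estimate `p ≤ x (1 - x)^d`
  set x : ℝ := 1 / (((max d 1 : ℕ) : ℝ) + 1) with hx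
  have hx0 : 0 < x := by rw [hx]; positivity
  have hx1 : x ≤ 1 / 2 := by
    rw [hx, div_le_div_iff₀ (by positivity) (by norm_num)]
    have : (1 : ℝ) ≤ ((max d 1 : ℕ) : ℝ) := by exact_mod_cast le_max_right d 1
    linarith
  have h1x : 0 ≤ 1 - x := by linarith
  have hkey : p ≤ x * (1 - x) ^ d := by
    rcases Nat.eq_zero_or_pos d with rfl | hdpos
    · -- `d = 0`: `x = 1/2 ≥ 1/e ≥ p`
      have hxe : x = 1 / 2 := by rw [hx]; norm_num
      rw [hxe, pow_zero, mul_one]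
      calc p ≤ 1 / (Real.exp 1 * ((0 : ℕ) : ℝ) + Real.exp 1 * 1) := by simpa [mul_add] using hpe
        _ = 1 / Real.exp 1 := by norm_num
        _ ≤ 1 / 2 := one_div_le_one_div_of_le (by norm_num) he2
    · -- `d ≥ 1`: `x = 1/(d+1)` and `(1 - x)^d ≥ 1/e`
      have hmax : ((max d 1 : ℕ) : ℝ) = d := by rw [max_eq_left hdpos]
      have hxe : x = 1 / ((d : ℝ) + 1) := by rw [hx, hmax]
      have hpow : Real.exp (-1) ≤ (1 - x) ^ d := by
        rw [hxe]; exact exp_neg_one_le_one_sub_div_pow d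
      have hexp1 : Real.exp (-1) = 1 / Real.exp 1 := by rw [Real.exp_neg, one_div]
      calc p ≤ 1 / (Real.exp 1 * ((d : ℝ) + 1)) := hpe
        _ = (1 / ((d : ℝ) + 1)) * (1 / Real.exp 1) := by field_simp
        _ ≤ x * (1 - x) ^ d := by
            rw [← hxe, ← hexp1]
            exact mul_le_mul_of_nonneg_left hpow hx0.le
  -- the asymmetric local lemma with constant weights
  refine exists_forall_not_mem_of_variable I A vbl hdet (fun _ => x) (fun _ => hx0.le)
    (fun _ => by linarith) (fun _ _ => by linarith) fun i hi => ?_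
  have hN : (0 : ℝ) ≤ Fintype.card (V → κ) := Nat.cast_nonneg _
  have hprod : (1 - x) ^ d
      ≤ ∏ j ∈ I.filter (fun j => j ≠ i ∧ ¬ Disjoint (vbl i) (vbl j)), (1 - x) := by
    rw [prod_const]
    exact pow_le_pow_of_le_one h1x (by linarith) (hd i hi)
  calc ((A i).card : ℝ) ≤ p * Fintype.card (V → κ) := hp i hi
    _ ≤ x * (1 - x) ^ d * Fintype.card (V → κ) := mul_le_mul_of_nonneg_right hkey hN
    _ ≤ x * (∏ j ∈ I.filter (fun j => j ≠ i ∧ ¬ Disjoint (vbl i) (vbl j)), (1 - x))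
          * Fintype.card (V → κ) :=
        mul_le_mul_of_nonneg_right (mul_le_mul_of_nonneg_left hprod hx0.le) hN

end Literature.Probability.Independence
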